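import Mathlib
import Literature.Computability.Complexity.KWProtocol
import Literature.Computability.Complexity.KWProtocolFormula
import Summits.ValiantsHypothesis.ValiantsHypothesis.Theses.ShallowShadows

/-!
# Stub `stub_kwFormula` — crux `ShadowFormulaTransfer` (stmt-ValiantsHypothesis-17124), line `det-kw`

Registered stub `stub_kwFormula` of line `det-kw` (tree `Cruxes/ShadowFormulaTransfer/Lines/det_kw.lean`)
for the crux `Summit.ValiantsHypothesis.ValiantsHypothesis.Theses.ShallowShadows.ShadowFormulaTransfer`
(item `stmt-ValiantsHypothesis-17124`, route `ShallowShadows`): **Karchmer–Wigderson, protocol ⟹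
monotone formula** — a deterministic protocol tree `P : KWTree ι` of depth `D` solving the MONOTONE
Karchmer–Wigderson game of `h` (`P.SolvesMono h`) bounds the monotone formula complexity
`formulaSizeOver monotoneBasis h ≤ 2 ^ D` (for constant `h` the left-hand side is the junk value
`0`). The proof IS the Literature theorem
`Literature.Computability.Complexity.KWTree.formulaSizeOver_le_two_pow_depth`
(`Literature/Computability/Complexity/KWProtocolFormula.lean`: induction on the tree over nonempty
rectangles, leaves ↦ inputs, Alice nodes ↦ `∨₂`, Bob nodes ↦ `∧₂`, empty sub-rectangles pruned;
constants excluded by `Circuit.eval_const_of_isOver_monotoneBasis`), on the Literature protocol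
trees of `Literature/Computability/Complexity/KWProtocol.lean`.
[cite: KarchmerWigderson1990, Thm. (d_m(f) = C(R_f^m)), easy direction]
[cite: JuknaBFC2012, §3.3, Thm. 3.13]
-/

set_option linter.dupNamespace false -- single-conjunct summit: `ValiantsHypothesis.ValiantsHypothesis`

noncomputable section

namespace Summit.ValiantsHypothesis.ValiantsHypothesis.Theorems.ShallowShadowsShadowFormulaTransfer

open Literature.Computability.Complexity

/-- **Karchmer–Wigderson, protocol ⟹ monotone formula** (registered stub `stub_kwFormula` of
line det-kw, crux stmt-ValiantsHypothesis-17124): if a deterministic protocol tree `P` solves the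
monotone Karchmer–Wigderson game of `h : (ι → Bool) → Bool` (on every `a ∈ h⁻¹(1)`, `b ∈ h⁻¹(0)`
it outputs a coordinate `i` with `a i = 1`, `b i = 0`), then `h` has a `{∧₂, ∨₂}`-formula with at
most `2 ^ P.depth` gates, i.e. `formulaSizeOver monotoneBasis h ≤ 2 ^ P.depth` (for constant `h`,
which no monotone formula computes, the left-hand side is the junk value `0`). Proof: the
Literature theorem `KWTree.formulaSizeOver_le_two_pow_depth`.
[cite: KarchmerWigderson1990, Thm. (d_m(f) = C(R_f^m)), easy direction]
[cite: JuknaBFC2012, §3.3, Thm. 3.13] -/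
theorem stub_kwFormula : ∀ (ι : Type) [Fintype ι] (h : (ι → Bool) → Bool) (P : KWTree ι),
    P.SolvesMono h → formulaSizeOver monotoneBasis h ≤ 2 ^ P.depth :=
  fun _ _ _ P hP => KWTree.formulaSizeOver_le_two_pow_depth P hP

end Summit.ValiantsHypothesis.ValiantsHypothesis.Theorems.ShallowShadowsShadowFormulaTransfer

end
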